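import Literature.NumberTheory.EllipticCurves.DeShalit1987.RayClassTowerDiagonal
import HarnessLib

/-!
# de Shalit 1987, II.4.14 Step 1 / II.4.16 at a SPLIT prime `(p) = v·v̄`: the diagonal tower
# `V_n = Gal(K̄/K(𝔪_n v^{n+1}))` over moduli cofinal with the powers of `𝔤v̄` exhausts `K(𝔣p^∞)`

Sequel of `RayClassTowerDiagonal.lean` (the cofinality criterion
`iInter_diagonal_absRayAdicTower_subset_rayKer`: `∀ m ≥ 1 ∃ n, 𝔪_n v^{n+1} ⊆ 𝔪_S^m` gives
`⋂_n V_n ⊆ rayKer K p S = Gal(K̄/K(𝔣p^∞))`, `𝔣 = ∏_{w∈S} w^∞`, `𝔪_S = (p)·𝔤`, `𝔤 = ∏_{w∈S} w`).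
Here `p` SPLITS, `v·v̄ ⊆ (p)` (de Shalit II: `p = 𝔭𝔭̄`; the measure of II.4.12 at modulus `𝔣 = 𝔤𝔭̄^m`
lives along the `𝔭 = v`-tower, and II.4.14 Step 1 glues over `m` — and, for the pseudo-ideal
`∏_{w∈S} w^∞` of II.4.16, over the powers of `𝔤` as well):

* §4 `mul_pow_le_rayModulus_pow` (`J ⊆ (𝔤v̄)^m`, `m ≤ n+1` ⟹ `J·v^{n+1} ⊆ 𝔪_S^m`), hence
  ★★ `iInter_diagonal_absRayAdicTower_subset_rayKer_of_split`: for an antitone sequence of moduli with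
  **`∀ m ∃ n, 𝔪_n ⊆ (𝔤v̄)^m`** the diagonal tower satisfies `⋂_n V_n ⊆ rayKer K p S` — BOTH the `𝔤`-power
  and the `v̄`-power must grow (with a FIXED `𝔤` and `𝔪_m = 𝔤v̄^{m+1}` one only reaches
  `Gal(K̄/K(𝔤p^∞)) ⊋ Gal(K̄/K(𝔣p^∞))` when `S ≠ ∅`); the converse `rayKer ≤ V_n` when every `𝔪_M`
  contains a power of `𝔤v̄`, the equality `…_eq_rayKer_of_split`; the instance `𝔪_M = (𝔤v̄)^{M+1}`
  (`…_pow_subset_rayKer`, `…_pow_eq_rayKer`); `(p) = v·v̄` for `[K:ℚ] = 2`, `p ∈ v`, `p ∈ v̄`, `v ≠ v̄`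
  (`span_natCast_eq_mul_of_finrank_eq_two`), whence the clause `⋂_n U_n ⊆ rayKer K p S` (+ open levels)
  of `thmII414_exists_lMeasure` / `IsLMeasure.isKatzDistribution₂` for the lane's diagonal tower over an
  imaginary quadratic `K` (`…_of_finrank_eq_two`, `isOpen_and_iInter_…`);
* §5 chains of single prime steps `𝔣_{k+1} = 𝔣_k·𝔩_k`, `𝔩_k` a prime of `S ∪ {v̄}` (the shape in which
  II.4.12 (ii) / II.2.5 (i) change the modulus): the cofinality hypothesis holds as soon as every prime of
  `S ∪ {v̄}` occurs infinitely often (`exists_le_prod_mul_pow_of_frequently`), and the support hypothesis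
  as soon as `𝔣_0 ⊇ (𝔤v̄)^{k₀}` (`exists_prod_mul_pow_le_of_steps`).

THEOREMS ONLY; no named fact, no definition, no instance, no `sorry`.

## References

* [deShalit1987] E. de Shalit, *Iwasawa theory of elliptic curves with complex multiplication* (1987),
  II.4.12 (ii) and Remark (i) (p. 67), II.4.14 Step 1 (p. 71), II.4.16 (p. 76), II.4.17 (p. 77–78).
* [NeukirchANT1999] J. Neukirch, *Algebraic Number Theory* (1999), Ch. I §8 (8.2)–(8.3), Ch. VI §6 (6.2)–(6.7).
-/

noncomputable section

open scoped NumberField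
open NumberField IsDedekindDomain Field
open Literature.NumberTheory.GaloisRepresentations Literature.NumberTheory.NumberFields

namespace Literature.NumberTheory.EllipticCurves

namespace DeShalit1987

variable {K : Type} [Field K] [NumberField K] (p : ℕ) (S : Finset (HeightOneSpectrum (𝓞 K)))

/-! ### §4. The split case `(p) ⊇ v·v̄`: moduli `𝔪_n` cofinal with the powers of `𝔤v̄`, `𝔤 = ∏_{w∈S} w` -/

section Split

variable {v vbar : HeightOneSpectrum (𝓞 K)}

omit [NumberField K] in
/-- `𝔤v̄ ≠ 0` for `𝔤 = ∏_{w∈S} w`. [cite: deShalit1987, II.4.14 Step 1 (p. 71)] -/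
theorem prod_mul_ne_bot : (∏ w ∈ S, w.asIdeal) * vbar.asIdeal ≠ ⊥ :=
  mul_ne_zero (Finset.prod_ne_zero_iff.mpr fun w _ ↦ w.ne_bot) vbar.ne_bot

omit [NumberField K] in
/-- The powers of `𝔤v̄` are non-zero. [cite: deShalit1987, II.4.14 Step 1 (p. 71)] -/
theorem prod_mul_pow_ne_bot (M : ℕ) : ((∏ w ∈ S, w.asIdeal) * vbar.asIdeal) ^ M ≠ ⊥ :=
  pow_ne_zero M (prod_mul_ne_bot S)

/-- **At a split prime `v·v̄ ⊆ (p)`: `J·v^{n+1} ⊆ 𝔪_S^m` as soon as `J ⊆ (𝔤v̄)^m` and `m ≤ n+1`**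
(`(𝔤v̄)^m v^m = (𝔤·v̄v)^m ⊆ (𝔤·(p))^m = 𝔪_S^m`). [cite: deShalit1987, II.4.14 Step 1 (p. 71), II.4.12 Remark (i) (p. 67)] -/
theorem mul_pow_le_rayModulus_pow (hp : v.asIdeal * vbar.asIdeal ≤ Ideal.span {(p : 𝓞 K)})
    {J : Ideal (𝓞 K)} {m n : ℕ} (hJ : J ≤ ((∏ w ∈ S, w.asIdeal) * vbar.asIdeal) ^ m) (hn : m ≤ n + 1) :
    J * v.asIdeal ^ (n + 1) ≤ rayModulus K p S ^ m := by
  have h1 : (∏ w ∈ S, w.asIdeal) * vbar.asIdeal * v.asIdeal ≤ rayModulus K p S := by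
    rw [rayModulus, mul_comm (Ideal.span _), mul_assoc, mul_comm vbar.asIdeal]
    exact Ideal.mul_mono_right hp
  calc J * v.asIdeal ^ (n + 1)
      ≤ ((∏ w ∈ S, w.asIdeal) * vbar.asIdeal) ^ m * v.asIdeal ^ m :=
        Ideal.mul_mono hJ (Ideal.pow_le_pow_right hn)
    _ = ((∏ w ∈ S, w.asIdeal) * vbar.asIdeal * v.asIdeal) ^ m := (mul_pow _ _ m).symm
    _ ≤ rayModulus K p S ^ m := Ideal.pow_right_mono h1 m

/-- **`𝔤v̄` lies in no prime `w ∉ S`, `w ∤ p`** when `p ∈ v̄` (its prime support is `S ∪ {v̄}`).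
[cite: deShalit1987, II.4.12 Remark (i) (p. 67)] -/
theorem not_prod_mul_le (hvbar : (p : 𝓞 K) ∈ vbar.asIdeal) (w : HeightOneSpectrum (𝓞 K)) (hwS : w ∉ S)
    (hwp : (p : 𝓞 K) ∉ w.asIdeal) : ¬ (∏ w ∈ S, w.asIdeal) * vbar.asIdeal ≤ w.asIdeal := by
  intro hle
  rcases (w.isPrime.mul_le).mp hle with h | h
  · obtain ⟨w', hw'S, hw'⟩ := (w.isPrime.prod_le).mp h
    have hww : w' = w := HeightOneSpectrum.ext (w'.isMaximal.eq_of_le w.isPrime.ne_top hw')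
    exact hwS (hww ▸ hw'S)
  · have hww : vbar = w := HeightOneSpectrum.ext (vbar.isMaximal.eq_of_le w.isPrime.ne_top h)
    exact hwp (hww ▸ hvbar)

variable {𝔪 : ℕ → Ideal (𝓞 K)} (h𝔪 : ∀ M, 𝔪 M ≠ ⊥)
  (href : ∀ M n, (absRayAdicTower (h𝔪 (M + 1)) v).U n ≤ (absRayAdicTower (h𝔪 M) v).U n)

/-- ★★ **The split case: `⋂_n Gal(K̄/K(𝔪_n v^{n+1})) ⊆ Gal(K̄/K(𝔣p^∞))` as soon as the moduli become
divisible by every power of `𝔤v̄`** (`K` totally complex, `v·v̄ ⊆ (p)`, `𝔪` antitone with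
`∀ m ∃ n, 𝔪_n ⊆ (𝔤v̄)^m`, `𝔤 = ∏_{w∈S} w`) — de Shalit's diagonal `Gal(K̄/K(𝔤^·𝔭̄^·𝔭^·))`; covers
`𝔪_M = 𝔤^{M+1}v̄^{M+1}` and every shifted variant. NOTE: with a FIXED `𝔤` and only the `v̄`-power growing
the intersection is `Gal(K̄/K(𝔤p^∞))`, strictly bigger than `rayKer K p S` when `S ≠ ∅`; both powers must
grow (II.4.16). [cite: deShalit1987, II.4.14 Step 1 (p. 71), II.4.16 (p. 76)] -/
theorem iInter_diagonal_absRayAdicTower_subset_rayKer_of_split [IsTotallyComplex K] [Fact p.Prime]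
    (hp : v.asIdeal * vbar.asIdeal ≤ Ideal.span {(p : 𝓞 K)}) (hanti : ∀ M, 𝔪 (M + 1) ≤ 𝔪 M)
    (hcof : ∀ m : ℕ, ∃ n, 𝔪 n ≤ ((∏ w ∈ S, w.asIdeal) * vbar.asIdeal) ^ m) :
    ⋂ n, ((SubgroupTower.diagonal (fun M ↦ absRayAdicTower (h𝔪 M) v) href).U n :
      Set (absoluteGaloisGroup K)) ⊆ rayKer K p S := by
  refine iInter_diagonal_absRayAdicTower_subset_rayKer p S h𝔪 v href fun m _ ↦ ?_
  obtain ⟨n, hn⟩ := hcof m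
  refine ⟨max n m, mul_pow_le_rayModulus_pow p S hp
    ((antitone_nat_of_succ_le hanti (le_max_left n m)).trans hn) ?_⟩
  exact (le_max_right n m).trans (Nat.le_succ _)

/-- **`Gal(K̄/K(𝔣p^∞)) ≤ V_n` for every level in the split case** when, conversely, every `𝔪_M` contains
a power of `𝔤v̄` (so `𝔪_M v^{M+1}` is supported on `S ∪ {v, v̄} ⊆ S ∪ {w ∣ p}`).
[cite: deShalit1987, II.4.12 Remark (i) (p. 67), II.4.16 (p. 76)] -/
theorem rayKer_le_diagonal_absRayAdicTower_U_of_split (hv : (p : 𝓞 K) ∈ v.asIdeal)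
    (hvbar : (p : 𝓞 K) ∈ vbar.asIdeal)
    (hdiv : ∀ M : ℕ, ∃ k, ((∏ w ∈ S, w.asIdeal) * vbar.asIdeal) ^ k ≤ 𝔪 M) (n : ℕ) :
    rayKer K p S ≤ (SubgroupTower.diagonal (fun M ↦ absRayAdicTower (h𝔪 M) v) href).U n := by
  refine rayKer_le_diagonal_absRayAdicTower_U p S h𝔪 v href (fun M w hwS hwp ↦ ?_) n
  obtain ⟨k, hk⟩ := hdiv M
  exact not_mul_pow_succ_le_of_pow_le p S v (not_prod_mul_le p S hvbar) hk (Or.inl hv) M w hwS hwp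

/-- ★ **`⋂_n V_n = Gal(K̄/K(𝔣p^∞))` in the split case**: for `𝔪` antitone, cofinal with the powers of `𝔤v̄`
and each `𝔪_M` containing a power of `𝔤v̄`, the diagonal tower presents EXACTLY `𝒢(𝔣p^∞)`.
[cite: deShalit1987, II.4.14 Step 1 (p. 71), II.4.16 (p. 76)] -/
theorem iInter_diagonal_absRayAdicTower_eq_rayKer_of_split [IsTotallyComplex K] [Fact p.Prime]
    (hp : v.asIdeal * vbar.asIdeal ≤ Ideal.span {(p : 𝓞 K)}) (hv : (p : 𝓞 K) ∈ v.asIdeal)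
    (hvbar : (p : 𝓞 K) ∈ vbar.asIdeal) (hanti : ∀ M, 𝔪 (M + 1) ≤ 𝔪 M)
    (hcof : ∀ m : ℕ, ∃ n, 𝔪 n ≤ ((∏ w ∈ S, w.asIdeal) * vbar.asIdeal) ^ m)
    (hdiv : ∀ M : ℕ, ∃ k, ((∏ w ∈ S, w.asIdeal) * vbar.asIdeal) ^ k ≤ 𝔪 M) :
    ⋂ n, ((SubgroupTower.diagonal (fun M ↦ absRayAdicTower (h𝔪 M) v) href).U n :
      Set (absoluteGaloisGroup K)) = rayKer K p S :=
  Set.Subset.antisymm (iInter_diagonal_absRayAdicTower_subset_rayKer_of_split p S h𝔪 href hp hanti hcof)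
    (rayKer_subset_iInter_of_forall_le p S _
      (rayKer_le_diagonal_absRayAdicTower_U_of_split p S h𝔪 href hv hvbar hdiv))

/-- ★★ **The instance `𝔪_M = (𝔤v̄)^{M+1} = 𝔤^{M+1}v̄^{M+1}`** (de Shalit's `𝔣 = 𝔤𝔭̄^m` with the `𝔤`-power
growing alongside, II.4.16): `⋂_n Gal(K̄/K((𝔤v̄v)^{n+1})) ⊆ Gal(K̄/K(𝔣p^∞))` at a split `v·v̄ ⊆ (p)`, for
ANY refinement proof `href`. [cite: deShalit1987, II.4.14 Step 1 (p. 71), II.4.16 (p. 76)] -/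
theorem iInter_diagonal_absRayAdicTower_pow_subset_rayKer [IsTotallyComplex K] [Fact p.Prime]
    (hp : v.asIdeal * vbar.asIdeal ≤ Ideal.span {(p : 𝓞 K)})
    (href : ∀ M n, (absRayAdicTower (prod_mul_pow_ne_bot S (vbar := vbar) (M + 1 + 1)) v).U n ≤
      (absRayAdicTower (prod_mul_pow_ne_bot S (vbar := vbar) (M + 1)) v).U n) :
    ⋂ n, ((SubgroupTower.diagonal
        (fun M ↦ absRayAdicTower (prod_mul_pow_ne_bot S (vbar := vbar) (M + 1)) v) href).U n :
      Set (absoluteGaloisGroup K)) ⊆ rayKer K p S :=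
  iInter_diagonal_absRayAdicTower_subset_rayKer_of_split p S
    (𝔪 := fun M ↦ ((∏ w ∈ S, w.asIdeal) * vbar.asIdeal) ^ (M + 1)) (fun M ↦ prod_mul_pow_ne_bot S (M + 1))
    href hp (fun _ ↦ Ideal.pow_le_pow_right (Nat.le_succ _))
    fun m ↦ ⟨m, Ideal.pow_le_pow_right (Nat.le_succ m)⟩

/-- The same instance, as an EQUALITY `⋂_n Gal(K̄/K((𝔤v̄v)^{n+1})) = Gal(K̄/K(𝔣p^∞))` (`p ∈ v`, `p ∈ v̄`).
[cite: deShalit1987, II.4.14 Step 1 (p. 71), II.4.16 (p. 76)] -/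
theorem iInter_diagonal_absRayAdicTower_pow_eq_rayKer [IsTotallyComplex K] [Fact p.Prime]
    (hp : v.asIdeal * vbar.asIdeal ≤ Ideal.span {(p : 𝓞 K)}) (hv : (p : 𝓞 K) ∈ v.asIdeal)
    (hvbar : (p : 𝓞 K) ∈ vbar.asIdeal)
    (href : ∀ M n, (absRayAdicTower (prod_mul_pow_ne_bot S (vbar := vbar) (M + 1 + 1)) v).U n ≤
      (absRayAdicTower (prod_mul_pow_ne_bot S (vbar := vbar) (M + 1)) v).U n) :
    ⋂ n, ((SubgroupTower.diagonal
        (fun M ↦ absRayAdicTower (prod_mul_pow_ne_bot S (vbar := vbar) (M + 1)) v) href).U n :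
      Set (absoluteGaloisGroup K)) = rayKer K p S :=
  iInter_diagonal_absRayAdicTower_eq_rayKer_of_split p S
    (𝔪 := fun M ↦ ((∏ w ∈ S, w.asIdeal) * vbar.asIdeal) ^ (M + 1)) (fun M ↦ prod_mul_pow_ne_bot S (M + 1))
    href hp hv hvbar (fun _ ↦ Ideal.pow_le_pow_right (Nat.le_succ _))
    (fun m ↦ ⟨m, Ideal.pow_le_pow_right (Nat.le_succ m)⟩) fun M ↦ ⟨M + 1, le_rfl⟩

/-- **`(p) = v·v̄` for a prime split into two distinct primes of a quadratic field**: `[K:ℚ] = 2`,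
`p ∈ v`, `p ∈ v̄`, `v ≠ v̄` give `p𝓞_K = v·v̄` — both contain `p` and are comaximal, so `p𝓞_K ⊆ v ∩ v̄ = vv̄`,
`p𝓞_K = vv̄J`, and counting norms `p² = N(v)N(v̄)N(J)` with `p ∣ N(v), N(v̄)` forces `J = 1`.
[cite: NeukirchANT1999, Ch. I §8 Prop. (8.2)–(8.3)] -/
theorem span_natCast_eq_mul_of_finrank_eq_two (hK2 : Module.finrank ℚ K = 2) (hpr : p.Prime)
    (hv : (p : 𝓞 K) ∈ v.asIdeal) (hvbar : (p : 𝓞 K) ∈ vbar.asIdeal) (hne : vbar ≠ v) :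
    Ideal.span {(p : 𝓞 K)} = v.asIdeal * vbar.asIdeal := by
  classical
  have hne' : v.asIdeal ≠ vbar.asIdeal := fun h ↦ hne (HeightOneSpectrum.ext h.symm)
  -- `(p) ≤ v ⊓ v̄ = v·v̄`
  have hle : Ideal.span {(p : 𝓞 K)} ≤ v.asIdeal * vbar.asIdeal := by
    rw [Ideal.mul_eq_inf_of_coprime (v.isMaximal.coprime_of_ne vbar.isMaximal hne')]
    exact le_inf ((Ideal.span_singleton_le_iff_mem _).mpr hv)
      ((Ideal.span_singleton_le_iff_mem _).mpr hvbar)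
  obtain ⟨J, hJ⟩ := Ideal.dvd_iff_le.mpr hle
  -- norms
  have hN : Ideal.absNorm (Ideal.span {(p : 𝓞 K)}) = p ^ 2 := by
    rw [Ideal.absNorm_span_singleton,
      show (p : 𝓞 K) = algebraMap ℤ (𝓞 K) (p : ℤ) by simp, Algebra.norm_algebraMap,
      NumberField.RingOfIntegers.rank, hK2, Int.natAbs_pow, Int.natAbs_natCast]
  have hdv : ∀ I : Ideal (𝓞 K), I ∣ Ideal.span {(p : 𝓞 K)} → I ≠ ⊤ → p ∣ Ideal.absNorm I := by
    intro I hI hI1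
    have h1 : Ideal.absNorm I ∣ p ^ 2 := hN ▸ map_dvd Ideal.absNorm hI
    obtain ⟨i, -, hi⟩ := (Nat.dvd_prime_pow hpr).mp h1
    have hi0 : i ≠ 0 := by
      rintro rfl
      rw [pow_zero] at hi
      exact hI1 (Ideal.absNorm_eq_one_iff.mp hi)
    rw [hi]
    exact dvd_pow_self p hi0
  have hpv : p ∣ Ideal.absNorm v.asIdeal :=
    hdv _ ⟨vbar.asIdeal * J, by rw [hJ, mul_assoc]⟩ v.isPrime.ne_top
  have hpvbar : p ∣ Ideal.absNorm vbar.asIdeal :=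
    hdv _ ⟨v.asIdeal * J, by rw [hJ, mul_comm v.asIdeal vbar.asIdeal, mul_assoc]⟩ vbar.isPrime.ne_top
  have hprod : Ideal.absNorm v.asIdeal * Ideal.absNorm vbar.asIdeal * Ideal.absNorm J = p ^ 2 := by
    rw [← map_mul, ← map_mul, ← hJ, hN]
  have hvv : Ideal.absNorm v.asIdeal * Ideal.absNorm vbar.asIdeal = p ^ 2 :=
    Nat.dvd_antisymm (hprod ▸ Dvd.intro _ rfl) (by rw [sq]; exact mul_dvd_mul hpv hpvbar)
  have hJ1 : Ideal.absNorm J = 1 := by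
    rw [hvv] at hprod
    nth_rw 2 [← mul_one (p ^ 2)] at hprod
    exact Nat.eq_of_mul_eq_mul_left (pow_pos hpr.pos 2) hprod
  rw [Ideal.absNorm_eq_one_iff] at hJ1
  rw [hJ, hJ1, Ideal.mul_top]

/-- ★★ **The R3-endpoint clause `⋂_n U_n ⊆ rayKer K p S` for the lane's diagonal tower over an imaginary
quadratic `K` with `p = v·v̄` split** (`[K:ℚ] = 2`, `K` totally complex, `p ∈ v`, `p ∈ v̄`, `v̄ ≠ v` — the
binders of `thmII414_exists_lMeasure` — and an antitone sequence of moduli cofinal with the powers of `𝔤v̄`).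
[cite: deShalit1987, II.4.14 Step 1 (p. 71), II.4.16 (p. 76), II.4.17 (p. 77–78)] -/
theorem iInter_diagonal_absRayAdicTower_subset_rayKer_of_finrank_eq_two [IsTotallyComplex K] [Fact p.Prime]
    (hK2 : Module.finrank ℚ K = 2) (hv : (p : 𝓞 K) ∈ v.asIdeal) (hvbar : (p : 𝓞 K) ∈ vbar.asIdeal)
    (hne : vbar ≠ v) (hanti : ∀ M, 𝔪 (M + 1) ≤ 𝔪 M)
    (hcof : ∀ m : ℕ, ∃ n, 𝔪 n ≤ ((∏ w ∈ S, w.asIdeal) * vbar.asIdeal) ^ m) :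
    ⋂ n, ((SubgroupTower.diagonal (fun M ↦ absRayAdicTower (h𝔪 M) v) href).U n :
      Set (absoluteGaloisGroup K)) ⊆ rayKer K p S :=
  iInter_diagonal_absRayAdicTower_subset_rayKer_of_split p S h𝔪 href
    (span_natCast_eq_mul_of_finrank_eq_two p hK2 (Fact.out : p.Prime) hv hvbar hne).symm.le hanti hcof

/-- The same, as the EQUALITY `⋂_n U_n = rayKer K p S`, when every `𝔪_M` also contains a power of `𝔤v̄`.
[cite: deShalit1987, II.4.14 Step 1 (p. 71), II.4.16 (p. 76)] -/
theorem iInter_diagonal_absRayAdicTower_eq_rayKer_of_finrank_eq_two [IsTotallyComplex K] [Fact p.Prime]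
    (hK2 : Module.finrank ℚ K = 2) (hv : (p : 𝓞 K) ∈ v.asIdeal) (hvbar : (p : 𝓞 K) ∈ vbar.asIdeal)
    (hne : vbar ≠ v) (hanti : ∀ M, 𝔪 (M + 1) ≤ 𝔪 M)
    (hcof : ∀ m : ℕ, ∃ n, 𝔪 n ≤ ((∏ w ∈ S, w.asIdeal) * vbar.asIdeal) ^ m)
    (hdiv : ∀ M : ℕ, ∃ k, ((∏ w ∈ S, w.asIdeal) * vbar.asIdeal) ^ k ≤ 𝔪 M) :
    ⋂ n, ((SubgroupTower.diagonal (fun M ↦ absRayAdicTower (h𝔪 M) v) href).U n :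
      Set (absoluteGaloisGroup K)) = rayKer K p S :=
  iInter_diagonal_absRayAdicTower_eq_rayKer_of_split p S h𝔪 href
    (span_natCast_eq_mul_of_finrank_eq_two p hK2 (Fact.out : p.Prime) hv hvbar hne).symm.le hv hvbar
    hanti hcof hdiv

/-- ★★ **The tower clause of `thmII414_exists_lMeasure` for the instance `𝔪_M = (𝔤v̄)^{M+1}` over an
imaginary quadratic `K` with `p = v·v̄` split**: open levels AND `⋂_n U_n ⊆ rayKer K p S`, packaged as the
conjunction the named fact asks for. [cite: deShalit1987, II Thm. 4.14 (p. 71), II.4.16 (p. 76), II.4.17 (p. 77–78)] -/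
theorem isOpen_and_iInter_diagonal_absRayAdicTower_pow_subset_rayKer [IsTotallyComplex K] [Fact p.Prime]
    (hK2 : Module.finrank ℚ K = 2) (hv : (p : 𝓞 K) ∈ v.asIdeal) (hvbar : (p : 𝓞 K) ∈ vbar.asIdeal)
    (hne : vbar ≠ v)
    (href : ∀ M n, (absRayAdicTower (prod_mul_pow_ne_bot S (vbar := vbar) (M + 1 + 1)) v).U n ≤
      (absRayAdicTower (prod_mul_pow_ne_bot S (vbar := vbar) (M + 1)) v).U n) :
    (∀ n, IsOpen ((SubgroupTower.diagonal
        (fun M ↦ absRayAdicTower (prod_mul_pow_ne_bot S (vbar := vbar) (M + 1)) v) href).U n :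
      Set (absoluteGaloisGroup K))) ∧
    ⋂ n, ((SubgroupTower.diagonal
        (fun M ↦ absRayAdicTower (prod_mul_pow_ne_bot S (vbar := vbar) (M + 1)) v) href).U n :
      Set (absoluteGaloisGroup K)) ⊆ rayKer K p S :=
  ⟨isOpen_diagonal_absRayAdicTower_U (fun M ↦ prod_mul_pow_ne_bot S (M + 1)) v href,
    iInter_diagonal_absRayAdicTower_pow_subset_rayKer p S
      (span_natCast_eq_mul_of_finrank_eq_two p hK2 (Fact.out : p.Prime) hv hvbar hne).symm.le href⟩

/-! ### §5. Chains of single prime steps `𝔣_{k+1} = 𝔣_k·𝔩_k` (II.4.12 (ii) / II.2.5 (i)): the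
cofinality and support hypotheses from the step structure -/

omit [NumberField K] in
/-- **One prime at a time**: if an antitone chain of moduli `𝔣` takes, for each `w` in a finite set `T`,
a `w`-step (`𝔣_{k+1} ⊆ 𝔣_k·w`) beyond every index, then beyond every index `N` it reaches
`𝔣_n ⊆ 𝔣_N · ∏_{w∈T} w`. (De Shalit's compatible system II.4.12 (ii) changes the modulus one prime `𝔩 ∣ 𝔣`
at a time, II.2.5 (i).) [cite: deShalit1987, II.4.12 (ii) (p. 67), II.4.16 (p. 76)] -/
theorem exists_le_mul_prod_of_frequently {𝔣 : ℕ → Ideal (𝓞 K)} (hanti : ∀ k, 𝔣 (k + 1) ≤ 𝔣 k)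
    (T : Finset (HeightOneSpectrum (𝓞 K)))
    (hT : ∀ w ∈ T, ∀ N : ℕ, ∃ k, N ≤ k ∧ 𝔣 (k + 1) ≤ 𝔣 k * w.asIdeal) (N : ℕ) :
    ∃ n, N ≤ n ∧ 𝔣 n ≤ 𝔣 N * ∏ w ∈ T, w.asIdeal := by
  classical
  induction T using Finset.induction_on with
  | empty => exact ⟨N, le_rfl, by rw [Finset.prod_empty, mul_one]⟩
  | insert w T hw ih =>
    obtain ⟨n, hNn, hn⟩ := ih fun w' hw' ↦ hT w' (Finset.mem_insert_of_mem hw')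
    obtain ⟨k, hnk, hk⟩ := hT w (Finset.mem_insert_self w T) n
    refine ⟨k + 1, hNn.trans (hnk.trans (Nat.le_succ k)), ?_⟩
    rw [Finset.prod_insert hw, mul_comm w.asIdeal, ← mul_assoc]
    exact hk.trans (Ideal.mul_mono_left ((antitone_nat_of_succ_le hanti hnk).trans hn))

omit [NumberField K] in
/-- ★ **Cofinality of a chain of single prime steps** (`v̄ ∉ S`): an antitone chain `𝔣` of moduli taking,
for each `w ∈ S ∪ {v̄}` (`w = v̄ ∨ w ∈ S`), a `w`-step `𝔣_{k+1} ⊆ 𝔣_k·w` beyond every index becomes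
divisible by every power
of `𝔤v̄` — the hypothesis `hcof` of `iInter_diagonal_absRayAdicTower_subset_rayKer_of_split` for the
chains `𝔣_{k+1} = 𝔣_k𝔩_k` (`𝔩_k` a prime of `S ∪ {v̄}`, each occurring infinitely often; a chain using
ONLY `𝔩_k = v̄` does NOT qualify when `S ≠ ∅`). [cite: deShalit1987, II.4.14 Step 1 (p. 71), II.4.16 (p. 76)] -/
theorem exists_le_prod_mul_pow_of_frequently {𝔣 : ℕ → Ideal (𝓞 K)} (hanti : ∀ k, 𝔣 (k + 1) ≤ 𝔣 k)
    (hvS : vbar ∉ S)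
    (hT : ∀ w : HeightOneSpectrum (𝓞 K), w = vbar ∨ w ∈ S →
      ∀ N : ℕ, ∃ k, N ≤ k ∧ 𝔣 (k + 1) ≤ 𝔣 k * w.asIdeal) :
    ∀ m : ℕ, ∃ n, 𝔣 n ≤ ((∏ w ∈ S, w.asIdeal) * vbar.asIdeal) ^ m := by
  classical
  have hT' : ∀ w ∈ insert vbar S, ∀ N : ℕ, ∃ k, N ≤ k ∧ 𝔣 (k + 1) ≤ 𝔣 k * w.asIdeal :=
    fun w hw ↦ hT w (Finset.mem_insert.mp hw)
  intro m
  induction m with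
  | zero => exact ⟨0, by rw [pow_zero, Ideal.one_eq_top]; exact le_top⟩
  | succ m ih =>
    obtain ⟨n, hn⟩ := ih
    obtain ⟨n', -, hn'⟩ := exists_le_mul_prod_of_frequently hanti (insert vbar S) hT' n
    refine ⟨n', hn'.trans ?_⟩
    rw [pow_succ, Finset.prod_insert hvS, mul_comm vbar.asIdeal]
    exact Ideal.mul_mono_left hn

omit [NumberField K] in
/-- **Support of a chain of prime steps**: if `𝔣_0` contains a power of `𝔤v̄` and every step divides by a
prime `w` of `S ∪ {v̄}` (`w = v̄ ∨ w ∈ S`, `𝔣_k·w ⊆ 𝔣_{k+1}`), every `𝔣_M` contains a power of `𝔤v̄` — the hypothesis `hdiv` of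
`rayKer_le_diagonal_absRayAdicTower_U_of_split` / `…_eq_rayKer_of_split`.
[cite: deShalit1987, II.4.12 Remark (i) (p. 67), II.4.14 Step 1 (p. 71)] -/
theorem exists_prod_mul_pow_le_of_steps {𝔣 : ℕ → Ideal (𝓞 K)} {k₀ : ℕ}
    (h0 : ((∏ w ∈ S, w.asIdeal) * vbar.asIdeal) ^ k₀ ≤ 𝔣 0)
    (hstep : ∀ k, ∃ w : HeightOneSpectrum (𝓞 K), (w = vbar ∨ w ∈ S) ∧ 𝔣 k * w.asIdeal ≤ 𝔣 (k + 1)) :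
    ∀ M : ℕ, ∃ k, ((∏ w ∈ S, w.asIdeal) * vbar.asIdeal) ^ k ≤ 𝔣 M := by
  intro M
  induction M with
  | zero => exact ⟨k₀, h0⟩
  | succ M ih =>
    obtain ⟨k, hk⟩ := ih
    obtain ⟨w, hw, hle⟩ := hstep M
    refine ⟨k + 1, le_trans ?_ hle⟩
    rw [pow_succ]
    refine Ideal.mul_mono hk ?_
    rcases hw with rfl | hw
    · exact Ideal.mul_le_left
    · exact Ideal.mul_le_right.trans ((Ideal.prod_le_inf).trans (Finset.inf_le hw))

end Split


end DeShalit1987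

end Literature.NumberTheory.EllipticCurves

end
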